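import Summits.FinalStateConjecture.FinalStateConjecture.Theorems.SwallowTheDatumUniversalWitnessFamilyStubRegionOneScriCone
import Summits.FinalStateConjecture.FinalStateConjecture.Theorems.SwallowTheDatumUniversalWitnessFamilyStubRegionOneScriRay
import Literature.Geometry.Lorentzian.FutureNullCompleteness
import Literature.Geometry.Lorentzian.NullInfinity
import HarnessLib

/-!
# Stub `stub_regionOneScri` of crux `SwallowTheDatum.UniversalWitnessFamily`
# (stmt-FinalStateConjecture-10051, line `Sketch` = `throat-settles-too`), part 4/4: relative far-origin
# sojourn completeness of region I (the sharp `a = 0` static ledger)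

`stub_regionOneScri` (registered stub M1 of the lead's skeleton, proved here): in the Schwarzschild
exterior `(Kerr.region 0 (2M), g_{M,0}, −g♯dt*)` with the static slice `ψ` of the open isotropic sheet
`{‖y‖ > M/2}` and its unit normal `ν = (1 − 2M/r)^{-1/2} ∂_{t*}`, future null infinity is complete in
Christodoulou's sojourn form relative to far origins: with `R₀ = M/2 + 1`, for every `s > 0` there is `R₁`
such that every normalised future null maximal geodesic from a sheet point `p` with `‖p‖ > R₁` is future
complete or spends affine time `≥ s` in `J⁺(ψ{R₀ ≤ ‖y‖ ≤ R₀ + 1})`.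

The ledger (Dafermos–Rodnianski arXiv:0811.0354, §2.6.2; Christodoulou, CQG 16 (1999), pp. A26–A27):
the Killing energy `E = −g(γ', ∂_{t*}) = √(1 − 2M/R_p) ∈ (0, 1]` is conserved and the null cone gives
`|ṙ| ≤ E`, `u̇, v̇, ṫ* ≥ 0` (`ray_kinematics`); an incomplete ray approaches `r = 2M`
(`exists_spatialNorm_lt`), so `u → +∞` (`exists_le_uKS`) and the ray enters `{u ≥ −r*(r₂)}`,
`r₂ = r(R₀ + 1)`, at a radius `r_e` with `2 r*(r_e) = v − u ≥ r*(R_p) + r*(r₂) > 2 r*(r₂ + s)` for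
`R_p` large; from entry until `r = r₂` it stays in `{r > r₂, u ≥ −r*(r₂)} ⊆ J⁺(ψ{‖y‖ = R₀ + 1})`
(`mem_causalFuture_outerSphere`) for affine time `≥ (r_e − r₂)/E > s`.

References: D. Christodoulou, CQG 16 (1999) A23, pp. A26–A27; M. Dafermos, I. Rodnianski,
arXiv:0811.0354, §2.6.2, §5.1; R. M. Wald, *General Relativity* (1984), §6.3.
-/

set_option linter.dupNamespace false

noncomputable section

namespace Summit.FinalStateConjecture.FinalStateConjecture.Theorems.SwallowTheDatum.UniversalWitnessFamily

open scoped Manifold ContDiff Topology RealInnerProductSpace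
open Set Function Filter Bundle Metric Literature.Geometry.Lorentzian

section Ray

variable {M : ℝ}

/-! ## Kinematics of a null ray of the exterior -/

/-- A real function with nonnegative derivative on an open interval is monotone there. [folklore] -/
theorem monotoneOn_of_hasDerivAt_nonneg_Ioo {dom : Set ℝ} (hopen : IsOpen dom)
    (hoc : dom.OrdConnected) {F F' : ℝ → ℝ} (hF : ∀ t ∈ dom, HasDerivAt F (F' t) t)
    (hF' : ∀ t ∈ dom, 0 ≤ F' t) :
    MonotoneOn F dom := by
  refine monotoneOn_of_hasDerivWithinAt_nonneg (f' := F') hoc.convex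
    (fun t ht ↦ (hF t ht).continuousAt.continuousWithinAt) (fun t ht ↦ ?_) (fun t ht ↦ ?_)
  · rw [hopen.interior_eq] at ht ⊢
    exact (hF t ht).hasDerivWithinAt
  · rw [hopen.interior_eq] at ht
    exact hF' t ht

/-- **Kinematics of a null ray of the Schwarzschild exterior.** Along a maximal geodesic `γ` of
`(Kerr.region 0 (2M), g_{M,0})` with conserved Killing energy `g(γ', ∂_{t*}) = −E < 0`, null velocity and
`(γ')⁰ > 0`: the retarded time `u`, the advanced time `v` and the Kerr–Schild time `t*` are nondecreasing
along `γ` (`u̇ = (E − ṙ)/(1 − 2M/r)`, `v̇ = (E + ṙ)/(1 − 2M/r)`, `ṫ* > 0`), `u ∘ γ` and `r ∘ γ` are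
continuous, and `r ∘ γ` is `E`-Lipschitz (`|ṙ| ≤ E`). Dafermos–Rodnianski arXiv:0811.0354, §2.6.2;
Wald 1984, (6.3.12)–(6.3.15). [folklore] -/
theorem ray_kinematics [Kerr.Facts] (hM : 0 < M)
    [(Kerr.smoothMetric M 0 (Kerr.rPlus M 0)).toPseudoRiemannianMetric.HasLeviCivita]
    {γ : ℝ → Kerr.region 0 (Kerr.rPlus M 0)} {dom : Set ℝ}
    (hmax : IsMaximalGeodesicOn
      (Kerr.smoothMetric M 0 (Kerr.rPlus M 0)).toPseudoRiemannianMetric.leviCivita γ dom)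
    {E : ℝ} (hE0 : 0 < E)
    (hE : ∀ t ∈ dom, Kerr.bilin M 0 (γ t) (velocity 𝓘(ℝ, E4) γ t) (E4.basisVector 0) = -E)
    (hnull : ∀ t ∈ dom,
      Kerr.bilin M 0 (γ t) (velocity 𝓘(ℝ, E4) γ t) (velocity 𝓘(ℝ, E4) γ t) = 0)
    (hfut : ∀ t ∈ dom, 0 < WithLp.ofLp (velocity 𝓘(ℝ, E4) γ t) 0) :
    MonotoneOn (fun t ↦ (γ t : E4) 0 - E4.spatialNorm (γ t : E4) -
        4 * M * Real.log (E4.spatialNorm (γ t : E4) / (2 * M) - 1)) dom ∧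
      MonotoneOn (fun t ↦ (γ t : E4) 0 + E4.spatialNorm (γ t : E4)) dom ∧
      MonotoneOn (fun t ↦ (γ t : E4) 0) dom ∧
      ContinuousOn (fun t ↦ (γ t : E4) 0 - E4.spatialNorm (γ t : E4) -
        4 * M * Real.log (E4.spatialNorm (γ t : E4) / (2 * M) - 1)) dom ∧
      ContinuousOn (fun t ↦ E4.spatialNorm (γ t : E4)) dom ∧
      ∀ t₀ ∈ dom, ∀ t₁ ∈ dom,
        |E4.spatialNorm (γ t₁ : E4) - E4.spatialNorm (γ t₀ : E4)| ≤ E * |t₁ - t₀| := by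
  have hopen := hmax.isOpen
  have hoc := hmax.2.1
  have h2M : 0 < 2 * M := by positivity
  set ρ : ℝ → ℝ := fun t ↦ E4.spatialNorm (γ t : E4) with hρ_def
  have hρM : ∀ t, 2 * M < ρ t := fun t ↦ two_mul_lt_spatialNorm hM.le (γ t)
  have hder : ∀ t ∈ dom, HasDerivAt (fun t' ↦ (γ t' : E4)) (velocity 𝓘(ℝ, E4) γ t) t :=
    fun t ht ↦ ray_hasDerivAt_coe M 0 _ hmax.isGeodesicOn ht
  -- the radial rate `ṙ = ⟨x⃗, γ'⃗⟩/r`, `|ṙ| ≤ E`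
  set ρ' : ℝ → ℝ := fun t ↦
    ⟪E4.spatial (γ t : E4), E4.spatial (velocity 𝓘(ℝ, E4) γ t)⟫ / ρ t with hρ'_def
  have hρd : ∀ t ∈ dom, HasDerivAt ρ (ρ' t) t :=
    fun t ht ↦ hasDerivAt_spatialNorm (hder t ht) (h2M.trans (hρM t)).ne'
  have hρ'E : ∀ t ∈ dom, |ρ' t| ≤ E :=
    fun t ht ↦ abs_radial_le_energy hM.le (hρM t) (hnull t ht) hE0.le (hE t ht)
  -- the time rate `ṫ* = (γ')⁰ > 0`
  have ht0d : ∀ t ∈ dom,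
      HasDerivAt (fun t' ↦ (γ t' : E4) 0) (WithLp.ofLp (velocity 𝓘(ℝ, E4) γ t) 0) t :=
    fun t ht ↦ (E4.dx 0).hasFDerivAt.comp_hasDerivAt t (hder t ht)
  -- the retarded-time rate `u̇ ≥ 0`
  have hud : ∀ t ∈ dom, HasDerivAt (fun t' ↦ (γ t' : E4) 0 - E4.spatialNorm (γ t' : E4) -
        4 * M * Real.log (E4.spatialNorm (γ t' : E4) / (2 * M) - 1))
      (WithLp.ofLp (velocity 𝓘(ℝ, E4) γ t) 0 - ρ' t -
        4 * M * ((ρ' t / (2 * M)) / (ρ t / (2 * M) - 1))) t := by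
    intro t ht
    have hpos : ρ t / (2 * M) - 1 ≠ 0 := by
      have : 1 < ρ t / (2 * M) := by rw [one_lt_div h2M]; exact hρM t
      linarith
    have hlog := (((hρd t ht).div_const (2 * M)).sub_const 1).log hpos
    exact ((ht0d t ht).sub (hρd t ht)).sub (hlog.const_mul (4 * M))
  have hu' : ∀ t ∈ dom, 0 ≤ WithLp.ofLp (velocity 𝓘(ℝ, E4) γ t) 0 - ρ' t -
      4 * M * ((ρ' t / (2 * M)) / (ρ t / (2 * M) - 1)) := by
    intro t ht
    have h := uRate_nonneg hM.le (hρM t) (hnull t ht) hE0.le (hE t ht)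
    have e : WithLp.ofLp (velocity 𝓘(ℝ, E4) γ t) 0 - ρ' t -
        4 * M * ((ρ' t / (2 * M)) / (ρ t / (2 * M) - 1)) =
        WithLp.ofLp (velocity 𝓘(ℝ, E4) γ t) 0 - ρ' t * (ρ t + 2 * M) / (ρ t - 2 * M) := by
      have hne : ρ t - 2 * M ≠ 0 := (sub_pos.2 (hρM t)).ne'
      have hq : (ρ' t / (2 * M)) / (ρ t / (2 * M) - 1) = ρ' t / (ρ t - 2 * M) := by
        rw [div_sub_one h2M.ne', div_div_div_cancel_right₀ h2M.ne']
      rw [hq, sub_sub, sub_right_inj, eq_div_iff hne]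
      simp only [add_mul, mul_assoc, div_mul_cancel₀ _ hne]
      ring
    rw [e]
    exact h
  -- the advanced-time rate `v̇ ≥ 0`
  have hvd : ∀ t ∈ dom,
      HasDerivAt (fun t' ↦ (γ t' : E4) 0 + E4.spatialNorm (γ t' : E4))
        (WithLp.ofLp (velocity 𝓘(ℝ, E4) γ t) 0 + ρ' t) t :=
    fun t ht ↦ (ht0d t ht).add (hρd t ht)
  have hv' : ∀ t ∈ dom, 0 ≤ WithLp.ofLp (velocity 𝓘(ℝ, E4) γ t) 0 + ρ' t :=
    fun t ht ↦ vRate_nonneg hM.le (hρM t) (hnull t ht) hE0.le (hE t ht)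
  refine ⟨monotoneOn_of_hasDerivAt_nonneg_Ioo hopen hoc hud hu',
    monotoneOn_of_hasDerivAt_nonneg_Ioo hopen hoc hvd hv',
    monotoneOn_of_hasDerivAt_nonneg_Ioo hopen hoc ht0d fun t ht ↦ (hfut t ht).le,
    fun t ht ↦ (hud t ht).continuousAt.continuousWithinAt,
    fun t ht ↦ (hρd t ht).continuousAt.continuousWithinAt, fun t₀ ht₀ t₁ ht₁ ↦ ?_⟩
  -- `r ∘ γ` is `E`-Lipschitz
  have h := hoc.convex.norm_image_sub_le_of_norm_hasDerivWithin_le (f := ρ)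
    (fun x hx ↦ (hρd x hx).hasDerivWithinAt)
    (fun x hx ↦ (by rw [Real.norm_eq_abs]; exact hρ'E x hx)) ht₀ ht₁
  rwa [Real.norm_eq_abs, Real.norm_eq_abs] at h

/-- **The retarded time is unbounded along an incomplete ray.** Under the hypotheses of
`ray_kinematics`, if the affine domain is bounded above then `u ∘ γ` exceeds every level `L` at some
parameter `t ≥ 0`: `γ` comes arbitrarily close to the horizon (`exists_spatialNorm_lt`), where
`−4M log(r/2M − 1) → +∞` while `t*` has not decreased and `r` stays bounded. Dafermos–Rodnianski
arXiv:0811.0354, §2.6.2 (`u → ∞` at `𝓗⁺`). [folklore] -/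
theorem exists_le_uKS [Kerr.Facts] (hM : 0 < M)
    [(Kerr.smoothMetric M 0 (Kerr.rPlus M 0)).toPseudoRiemannianMetric.HasLeviCivita]
    {γ : ℝ → Kerr.region 0 (Kerr.rPlus M 0)} {dom : Set ℝ}
    (hmax : IsMaximalGeodesicOn
      (Kerr.smoothMetric M 0 (Kerr.rPlus M 0)).toPseudoRiemannianMetric.leviCivita γ dom)
    (h0 : (0 : ℝ) ∈ dom) {E : ℝ}
    (hE : ∀ t ∈ dom, Kerr.bilin M 0 (γ t) (velocity 𝓘(ℝ, E4) γ t) (E4.basisVector 0) = -E)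
    (hnull : ∀ t ∈ dom,
      Kerr.bilin M 0 (γ t) (velocity 𝓘(ℝ, E4) γ t) (velocity 𝓘(ℝ, E4) γ t) = 0)
    (hmono : MonotoneOn (fun t ↦ (γ t : E4) 0) dom) (hb : BddAbove dom) (L : ℝ) :
    ∃ t ∈ dom, 0 ≤ t ∧ L ≤ (γ t : E4) 0 - E4.spatialNorm (γ t : E4) -
      4 * M * Real.log (E4.spatialNorm (γ t : E4) / (2 * M) - 1) := by
  have h2M : 0 < 2 * M := by positivity
  set A := |L| + |(γ 0 : E4) 0| + 2 * M + 1 with hA_def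
  set δ := min 1 (2 * M * Real.exp (-A / (4 * M))) with hδ_def
  have hδ : 0 < δ := lt_min one_pos (by positivity)
  obtain ⟨t, ht, ht0, hρ⟩ := exists_spatialNorm_lt hM hmax h0 hE hnull hb h0 le_rfl hδ
  refine ⟨t, ht, ht0, ?_⟩
  have hρM : 2 * M < E4.spatialNorm (γ t : E4) := two_mul_lt_spatialNorm hM.le (γ t)
  set ρ := E4.spatialNorm (γ t : E4) with hρ_def
  -- `log(ρ/2M − 1) ≤ log(δ/2M) ≤ −A/4M`
  have h1 : 0 < ρ / (2 * M) - 1 := by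
    rw [sub_pos, one_lt_div h2M]; exact hρM
  have h2 : ρ / (2 * M) - 1 ≤ Real.exp (-A / (4 * M)) := by
    have hδ' : δ ≤ 2 * M * Real.exp (-A / (4 * M)) := min_le_right _ _
    rw [sub_le_iff_le_add, div_le_iff₀ h2M]
    nlinarith
  have hlog : Real.log (ρ / (2 * M) - 1) ≤ -A / (4 * M) := by
    have := Real.log_le_log h1 h2
    rwa [Real.log_exp] at this
  have h3 : -(4 * M) * Real.log (ρ / (2 * M) - 1) ≥ A := by
    have h4M : 0 < 4 * M := by positivity
    have := mul_le_mul_of_nonneg_left hlog h4M.le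
    have e : 4 * M * (-A / (4 * M)) = -A := by field_simp
    linarith
  -- `t*` has not decreased, `ρ < 2M + 1`
  have ht' : (γ 0 : E4) 0 ≤ (γ t : E4) 0 := hmono h0 ht ht0
  have hρ1 : ρ < 2 * M + 1 :=
    lt_of_lt_of_le hρ (by linarith [min_le_left 1 (2 * M * Real.exp (-A / (4 * M)))])
  have hL : L ≤ |L| := le_abs_self L
  have hg0 : -|(γ 0 : E4) 0| ≤ (γ 0 : E4) 0 := neg_abs_le _
  linarith

end Ray

/-! ## The stub: relative far-origin sojourn completeness of region I -/

open scoped ENNReal in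
/-- **Stub M1 of line `Sketch` (= `throat-settles-too`) of crux `SwallowTheDatum.UniversalWitnessFamily`
(stmt-FinalStateConjecture-10051): relative far-origin sojourn completeness of `𝓘⁺` of region I, the
sharp `a = 0` static ledger.**  In the Schwarzschild exterior `(Kerr.region 0 (2M), g_{M,0}, −g♯dt*)` with
the static slice map `ψ` (`t* = 2M log(r/2M − 1)`, `x⃗ = (1 + M/2‖y‖)² y`, `r = ‖y‖(1 + M/2‖y‖)²`) and the
unit normal `ν = (1 − 2M/r)^{-1/2} ∂_{t*}`: with `R₀ := M/2 + 1`, for every `s > 0` there is `R₁` such that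
every normalised future null maximal geodesic `γ` from a sheet point `p`, `‖p‖ > R₁`, is future complete or
sojourns affine time `≥ s` in `J⁺(ψ{R₀ ≤ ‖y‖ ≤ R₀ + 1})`.  Proof (Dafermos–Rodnianski arXiv:0811.0354,
§2.6.2, Christodoulou CQG 16 (1999) pp. A26–A27, here for Schwarzschild in ingoing Kerr–Schild form,
§5.1): the Killing energy `E = −g(γ', ∂_{t*}) = √(1 − 2M/R_p) ∈ (0, 1]` is conserved (`ray_energy_eq`)
and the null cone gives `|ṙ| ≤ E`, `u̇, v̇ ≥ 0` (`ray_kinematics`); if the affine domain is bounded above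
the ray approaches `r = 2M` (`exists_spatialNorm_lt`, escape lemma), so `u → +∞` and the ray enters
`{u ≥ −r*(r₂)}`, `r₂ = r(R₀ + 1)`, at a radius `r_e` with `2 r*(r_e) = v − u ≥ r*(R_p) + r*(r₂)`, hence
`r_e > r₂ + s` once `r*(R_p) ≥ 2 r*(r₂ + s) − r*(r₂)`; from entry until `r = r₂` it stays in
`{r > r₂, u ≥ −r*(r₂)} ⊆ J⁺(ψ{‖y‖ = R₀ + 1})` (`mem_causalFuture_outerSphere`) for affine time
`≥ (r_e − r₂)/E > s`. [cite: Christodoulou1999, pp. A26–A27] [cite: arXiv08110354, §2.6.2, §5.1]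
[cite: Wald1984, §6.3, (6.3.12)–(6.3.15)] -/
theorem stub_regionOneScri :
  ∀ [Kerr.Facts] (M : ℝ) (hM : 0 < M)
    (ψ : Schwarzschild.isotropicExterior M → Kerr.region 0 (Kerr.rPlus M 0)) (ν : NormalField 𝓘(ℝ, E4) ψ),
    (∀ y, (ψ y : E4) =
      E4.ofTimeSpace (2 * M * Real.log (‖(y : E3)‖ * (1 + M / (2 * ‖(y : E3)‖)) ^ 2 / (2 * M) - 1))
        ((1 + M / (2 * ‖(y : E3)‖)) ^ 2 • (y : E3))) →
    (∀ y, ν y = (Real.sqrt (1 - 2 * M / (‖(y : E3)‖ * (1 + M / (2 * ‖(y : E3)‖)) ^ 2)))⁻¹ •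
      E4.basisVector 0) →
    ∀ [(Kerr.smoothMetric M 0 (Kerr.rPlus M 0)).toPseudoRiemannianMetric.HasLeviCivita],
    ∃ R₀ : ℝ, M / 2 < R₀ ∧ ∀ s : ℝ, 0 < s → ∃ R₁ : ℝ,
      ∀ p : Schwarzschild.isotropicExterior M, R₁ < ‖(p : E3)‖ →
        ∀ (γ : ℝ → Kerr.region 0 (Kerr.rPlus M 0)) (dom : Set ℝ),
          (Kerr.smoothMetric M 0 (Kerr.rPlus M 0)).IsNormalisedNullRayFrom
            ((Kerr.timeOrientation M 0 (Kerr.rPlus M 0) hM.le).ofLE le_top) ψ ν p γ dom →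
          ¬ BddAbove dom ∨ ENNReal.ofReal s ≤ sojournTime γ dom
            ((Kerr.smoothMetric M 0 (Kerr.rPlus M 0)).causalFuture
              ((Kerr.timeOrientation M 0 (Kerr.rPlus M 0) hM.le).ofLE le_top)
              (ψ '' {y | R₀ ≤ ‖(y : E3)‖ ∧ ‖(y : E3)‖ ≤ R₀ + 1})) := by
  intro _ M hM ψ ν hψ hν _
  haveI := contMDiffCovariantDerivative_leviCivita M 0 (Kerr.rPlus M 0)
  have h2M : 0 < 2 * M := by positivity
  -- the shell `R₀ ≤ ‖y‖ ≤ R₀ + 1` and the areal radius `r₂` of its outer sphere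
  set R₀ := M / 2 + 1 with hR₀_def
  set R := R₀ + 1 with hR_def
  have hR : M / 2 < R := by rw [hR_def, hR₀_def]; linarith
  set r₂ := R * (1 + M / (2 * R)) ^ 2 with hr₂_def
  have hr₂M : 2 * M < r₂ := two_mul_lt_arealRadius hM hR
  refine ⟨R₀, by rw [hR₀_def]; linarith, fun s hs ↦ ?_⟩
  -- tortoise radii `rs₂ = r*(r₂)`, `rss = r*(r₂ + s)`
  set rs₂ := r₂ + 2 * M * Real.log (r₂ / (2 * M) - 1) with hrs₂_def
  set rss := r₂ + s + 2 * M * Real.log ((r₂ + s) / (2 * M) - 1) with hrss_def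
  set R₁ := max (max (4 * M) (r₂ + 1)) (2 * rss - rs₂) with hR₁_def
  refine ⟨R₁, fun p hp γ dom hray ↦ ?_⟩
  obtain ⟨hmax, h0, hγ0, hnull0, hfut0, hnorm⟩ := hray
  by_cases hb : BddAbove dom
  swap
  · exact Or.inl hb
  right
  have hopen := hmax.isOpen
  have hoc := hmax.2.1
  -- ### the origin: areal radius `Rp`, `t* = 2M log(Rp/2M − 1)`
  have hpM : M / 2 < ‖(p : E3)‖ := p.2
  have hp0 : 0 < ‖(p : E3)‖ := by linarith
  set Rp := ‖(p : E3)‖ * (1 + M / (2 * ‖(p : E3)‖)) ^ 2 with hRp_def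
  have hRpM : 2 * M < Rp := two_mul_lt_arealRadius hM hpM
  have hRp0 : 0 < Rp := h2M.trans hRpM
  have hfac1 : 1 ≤ (1 + M / (2 * ‖(p : E3)‖)) ^ 2 := by
    have : 0 ≤ M / (2 * ‖(p : E3)‖) := by positivity
    nlinarith
  have hpRp : ‖(p : E3)‖ ≤ Rp := by
    rw [hRp_def]; nlinarith
  have hR₁p : R₁ < Rp := lt_of_lt_of_le hp hpRp
  have h4M : 4 * M ≤ Rp := by
    have : 4 * M ≤ R₁ := (le_max_left _ _).trans (le_max_left _ _); linarith
  have hr₂Rp : r₂ < Rp := by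
    have : r₂ + 1 ≤ R₁ := (le_max_right _ _).trans (le_max_left _ _); linarith
  set rsp := Rp + 2 * M * Real.log (Rp / (2 * M) - 1) with hrsp_def
  have hkey : 2 * rss < rsp + rs₂ := by
    have h1 : 2 * rss - rs₂ ≤ R₁ := le_max_right _ _
    have h2 : Rp ≤ rsp := le_rstar hM h4M
    linarith
  have hψp : (ψ p : E4) = E4.ofTimeSpace (2 * M * Real.log (Rp / (2 * M) - 1))
      ((1 + M / (2 * ‖(p : E3)‖)) ^ 2 • (p : E3)) := by
    rw [hψ p, hRp_def]
  have hrp : E4.spatialNorm (ψ p : E4) = Rp := by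
    rw [hψp, E4.spatialNorm_ofTimeSpace, norm_smul, Real.norm_of_nonneg (sq_nonneg _), hRp_def,
      mul_comm]
  have htp : (ψ p : E4) 0 = 2 * M * Real.log (Rp / (2 * M) - 1) := by
    rw [hψp, E4.ofTimeSpace_apply_zero]
  have hu0 : (γ 0 : E4) 0 - E4.spatialNorm (γ 0 : E4) -
      4 * M * Real.log (E4.spatialNorm (γ 0 : E4) / (2 * M) - 1) = -rsp := by
    rw [hγ0, hrp, htp, hrsp_def]; ring
  have hv0 : (γ 0 : E4) 0 + E4.spatialNorm (γ 0 : E4) = rsp := by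
    rw [hγ0, hrp, htp, hrsp_def]; ring
  -- ### the Killing energy `E = √(1 − 2M/Rp)`
  set E := Real.sqrt (1 - 2 * M / Rp) with hE_def
  have hE1 : 1 - 2 * M / Rp ≤ 1 := by
    have : 0 ≤ 2 * M / Rp := by positivity
    linarith
  have hEpos : 0 < 1 - 2 * M / Rp := by
    rw [sub_pos, div_lt_one hRp0]; exact hRpM
  have hE0 : 0 < E := Real.sqrt_pos.2 hEpos
  have hEle : E ≤ 1 := Real.sqrt_le_one.mpr hE1
  have hEγ0 : Kerr.bilin M 0 (γ 0) (velocity 𝓘(ℝ, E4) γ 0) (E4.basisVector 0) = -E := by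
    have hn : Kerr.bilin M 0 (ψ p) (velocity 𝓘(ℝ, E4) γ 0) (ν p) = -1 := hnorm
    rw [hν p, ← hRp_def, ← hE_def, map_smul, smul_eq_mul] at hn
    rw [hγ0]
    have hEne : E ≠ 0 := hE0.ne'
    field_simp at hn
    linarith
  -- ### conservation and the null cone along `γ`
  have hE : ∀ t ∈ dom, Kerr.bilin M 0 (γ t) (velocity 𝓘(ℝ, E4) γ t) (E4.basisVector 0) = -E :=
    fun t ht ↦ by rw [← hEγ0]; exact ray_energy_eq M 0 _ hopen hoc hmax.isGeodesicOn ht h0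
  have hnf := fun t (ht : t ∈ dom) ↦
    hmax.isGeodesicOn.isNull_and_isFutureDirected_velocity (Kerr.smoothMetric M 0 (Kerr.rPlus M 0))
      ((Kerr.timeOrientation M 0 (Kerr.rPlus M 0) hM.le).ofLE le_top) hopen hoc h0 hnull0 hfut0 ht
  have hnull : ∀ t ∈ dom,
      Kerr.bilin M 0 (γ t) (velocity 𝓘(ℝ, E4) γ t) (velocity 𝓘(ℝ, E4) γ t) = 0 :=
    fun t ht ↦ (hnf t ht).1.1
  have hfut : ∀ t ∈ dom, 0 < WithLp.ofLp (velocity 𝓘(ℝ, E4) γ t) 0 := fun t ht ↦ by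
    have h := (hnf t ht).2.2
    change Kerr.bilin M 0 (γ t) (Kerr.timeVector M 0 (γ t)) (velocity 𝓘(ℝ, E4) γ t) < 0 at h
    rw [Kerr.bilin_timeVector (Kerr.radius_pos_of_mem_region (γ t).2)] at h
    linarith
  obtain ⟨hmu, hmv, hmt, hcu, hcρ, hlip⟩ := ray_kinematics hM hmax hE0 hE hnull hfut
  have hρM : ∀ t, 2 * M < E4.spatialNorm (γ t : E4) := fun t ↦ two_mul_lt_spatialNorm hM.le (γ t)
  -- ### entry into `{u ≥ −r*(r₂)}` at a parameter `te ≥ 0`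
  have hur₂ : (γ 0 : E4) 0 - E4.spatialNorm (γ 0 : E4) -
      4 * M * Real.log (E4.spatialNorm (γ 0 : E4) / (2 * M) - 1) < -rs₂ := by
    rw [hu0, hrsp_def, hrs₂_def]; exact neg_lt_neg (rstar_lt_rstar hM hr₂M hr₂Rp)
  obtain ⟨t₁, ht₁, ht₁0, hut₁⟩ := exists_le_uKS hM hmax h0 hE hnull hmt hb (-rs₂)
  obtain ⟨te, hte, hute⟩ : ∃ te ∈ Icc 0 t₁, (γ te : E4) 0 - E4.spatialNorm (γ te : E4) -
      4 * M * Real.log (E4.spatialNorm (γ te : E4) / (2 * M) - 1) = -rs₂ :=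
    intermediate_value_Icc ht₁0 (hcu.mono (hoc.out h0 ht₁)) ⟨hur₂.le, hut₁⟩
  have hte_dom : te ∈ dom := hoc.out h0 ht₁ hte
  -- ### the radius at entry exceeds `r₂ + s`: `2 r*(r_e) = v − u ≥ r*(Rp) + r*(r₂) > 2 r*(r₂ + s)`
  have hre : r₂ + s < E4.spatialNorm (γ te : E4) := by
    have h1 : (γ 0 : E4) 0 + E4.spatialNorm (γ 0 : E4) ≤ (γ te : E4) 0 + E4.spatialNorm (γ te : E4) :=
      hmv h0 hte_dom hte.1
    have h2 := vKS_sub_uKS M (γ te : E4)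
    have h3 : rss < E4.spatialNorm (γ te : E4) +
        2 * M * Real.log (E4.spatialNorm (γ te : E4) / (2 * M) - 1) := by
      rw [hv0] at h1; rw [hute] at h2; rw [hrss_def]; linarith
    exact lt_of_rstar_lt hM (hρM te) h3
  -- ### the first parameter `tx > te` with `r ≤ r₂`
  obtain ⟨tw, htw, htew, hρw⟩ :=
    exists_spatialNorm_lt hM hmax h0 hE hnull hb hte_dom hte.1 (sub_pos.2 hr₂M)
  have hρw' : E4.spatialNorm (γ tw : E4) < r₂ := by linarith
  have hsubw : Icc te tw ⊆ dom := hoc.out hte_dom htw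
  set S : Set ℝ := Icc te tw ∩ (fun t ↦ E4.spatialNorm (γ t : E4)) ⁻¹' Iic r₂ with hS_def
  have hSc : IsClosed S :=
    (hcρ.mono hsubw).preimage_isClosed_of_isClosed isClosed_Icc isClosed_Iic
  have hSne : S.Nonempty := ⟨tw, right_mem_Icc.2 htew, hρw'.le⟩
  have hSbdd : BddBelow S := ⟨te, fun t ht ↦ ht.1.1⟩
  set tx := sInf S with htx_def
  have htxS : tx ∈ S := hSc.csInf_mem hSne hSbdd
  have htx_dom : tx ∈ dom := hsubw htxS.1
  have hIco : ∀ t ∈ Ico te tx, t ∈ dom ∧ r₂ < E4.spatialNorm (γ t : E4) := by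
    intro t ht
    have htI : t ∈ Icc te tw := ⟨ht.1, ht.2.le.trans htxS.1.2⟩
    refine ⟨hsubw htI, ?_⟩
    by_contra hle
    exact absurd (csInf_le hSbdd ⟨htI, not_lt.1 hle⟩) (not_le.2 ht.2)
  -- ### the duration: `r_e − r₂ ≤ E (tx − te) ≤ tx − te`
  have hdur : s < tx - te := by
    have htetx : te ≤ tx := htxS.1.1
    have h := hlip te hte_dom tx htx_dom
    rw [abs_of_nonneg (sub_nonneg.2 htetx)] at h
    have h' := neg_abs_le (E4.spatialNorm (γ tx : E4) - E4.spatialNorm (γ te : E4))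
    have h'' : E * (tx - te) ≤ 1 * (tx - te) :=
      mul_le_mul_of_nonneg_right hEle (sub_nonneg.2 htetx)
    have hρx : E4.spatialNorm (γ tx : E4) ≤ r₂ := htxS.2
    linarith
  -- ### the sojourn in `{r > r₂, u ≥ −r*(r₂)} ⊆ J⁺(ψ B₀)`
  have hJ : ∀ t ∈ Ico te tx, γ t ∈ (Kerr.smoothMetric M 0 (Kerr.rPlus M 0)).causalFuture
      ((Kerr.timeOrientation M 0 (Kerr.rPlus M 0) hM.le).ofLE le_top)
      (ψ '' {y | R₀ ≤ ‖(y : E3)‖ ∧ ‖(y : E3)‖ ≤ R₀ + 1}) := by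
    intro t ht
    obtain ⟨ht_dom, hρt⟩ := hIco t ht
    have hu : -rs₂ ≤ (γ t : E4) 0 - E4.spatialNorm (γ t : E4) -
        4 * M * Real.log (E4.spatialNorm (γ t : E4) / (2 * M) - 1) := by
      rw [← hute]; exact hmu hte_dom ht_dom ht.1
    refine LorentzianMetric.causalFuture_mono (Set.image_mono fun y hy ↦ ?_)
      (mem_causalFuture_outerSphere hM ψ hψ hR (γ t) hρt (by rwa [hrs₂_def] at hu))
    simp only [mem_setOf_eq] at hy ⊢
    rw [hy, hR_def]
    exact ⟨by linarith, le_rfl⟩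
  calc ENNReal.ofReal s ≤ ENNReal.ofReal (tx - te) := ENNReal.ofReal_le_ofReal hdur.le
    _ = MeasureTheory.volume (Ico te tx) := Real.volume_Ico.symm
    _ ≤ sojournTime γ dom _ :=
      MeasureTheory.measure_mono fun t ht ↦ ⟨(hIco t ht).1, hte.1.trans ht.1, hJ t ht⟩

end Summit.FinalStateConjecture.FinalStateConjecture.Theorems.SwallowTheDatum.UniversalWitnessFamily

end
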